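import Summits.PneNP.PneNP.Theorems.ExpanderLinearGeneratorsExpansionForcesDepthFregeSizeOfGaussianWidth

/-!
# PneNP / ExpanderLinearGenerators — `LinearGeneratorDepthFregeHard` follows from the
Gaussian-width law (stmt-PneNP-11443 ⇐ stmt-PneNP-11425, helper file)

Route `PneNP/ExpanderLinearGenerators`, support item stmt-PneNP-11443
(`Summit.PneNP.PneNP.Theses.ExpanderLinearGenerators.LinearGeneratorDepthFregeHard`, Krajíček's
Problem 19.4.5 in universal-expander form). The Gaussian-width law of the sibling route
`PneNP/MatroidTseitin` (item stmt-PneNP-11425) gives the expansion-scale law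
(`expansionForcesDepthFregeSize_of_gaussianWidthDepthFregeLB`, expansion gives Gaussian width),
and the expansion-scale law at scale `r := n^(1-δ)` is this item (the route's glue item
stmt-PneNP-11446, whose parameter bookkeeping — `ε' := (1-δ)ε`, `N` with `R ≤ n^(1-δ)` for
`n ≥ N` — is repeated here so that this file depends only on built modules).
References: Ben-Sasson–Wigderson 2001 §5–6 [BenSassonWigderson2001]; Krajíček,
*Proof Complexity* (2019), Problem 19.4.5, Cor. 13.4.6 [KrajicekProofComplexity2019].
-/

namespace Summit.PneNP.PneNP.Theorems

set_option linter.dupNamespace false -- `Summit.PneNP.PneNP.…`: summit = sub-problem (D-0017)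

open Filter

open Summit.PneNP.PneNP.Theses in
/-- **`GaussianWidthDepthFregeLB → LinearGeneratorDepthFregeHard`**: item stmt-PneNP-11443
(Krajíček's Problem 19.4.5, universal form) follows from the Gaussian-width law, item
stmt-PneNP-11425 of route `MatroidTseitin`, through the expansion-scale law (stmt-PneNP-11442)
taken at expansion scale `r := n^(1-δ)`: `ε' := (1-δ)·ε`, `N` large enough that `R ≤ n^(1-δ)`.
[cite: KrajicekProofComplexity2019, Problem 19.4.5] -/
theorem linearGeneratorDepthFregeHard_of_gaussianWidthDepthFregeLB
    (h : MatroidTseitin.GaussianWidthDepthFregeLB) :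
    ExpanderLinearGenerators.LinearGeneratorDepthFregeHard := by
  have hLaw := expansionForcesDepthFregeSize_of_gaussianWidthDepthFregeLB h
  intro ℓ d δ hℓ _hδ0 hδ1
  obtain ⟨ε, hε, R, hR⟩ := hLaw ℓ d hℓ
  have h1δ : 0 < 1 - δ := sub_pos.mpr hδ1
  -- the expansion scale `n ^ (1 - δ)` eventually exceeds the threshold `R`
  have hT : Tendsto (fun n : ℕ => ((n : ℝ)) ^ (1 - δ)) atTop atTop :=
    (tendsto_rpow_atTop h1δ).comp tendsto_natCast_atTop_atTop
  obtain ⟨N, hN⟩ := eventually_atTop.1 (hT.eventually_ge_atTop R)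
  refine ⟨(1 - δ) * ε, mul_pos h1δ hε, N, ?_⟩
  intro n hn m E hsparse hexp hunsat π hπ
  have hmain := hR ((n : ℝ) ^ (1 - δ)) (hN n hn) n m E hsparse hexp hunsat π hπ
  rwa [← Real.rpow_mul (Nat.cast_nonneg n)] at hmain

end Summit.PneNP.PneNP.Theorems
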